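import Mathlib
import Summits.Ventures.PercRepro2.HCov
import Summits.Ventures.PercRepro2.A3Fibre
import Summits.Ventures.PercRepro2.A3FibreA
import Summits.Ventures.PercRepro2.A3FibreFactors
import Summits.Ventures.PercRepro2.A3FibreMain
import Summits.Ventures.PercRepro2.A3RootEdgeAll
import Summits.Ventures.PercRepro2.A3RootEdgeClosure

/-!
# (MEANS-a₃) is symmetric in the two roots, and the root-edge closure at EITHER root
(blind cell PercRepro2, p5 g14; `proofs/P5-ROOTEDGE.md` §6, the a₂ mirror)

Under the root swap `a₁ ↔ a₂` the fibres `Q ∩ {C(a₃) = W}` are unchanged (`fibre_swap`), the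
`σ`-masses `Ssig` and the world sign `s3` change sign (on the non-empty fibres; a fibre containing
both roots is empty), the `U`-masses `Su`, the fibre masses `mW`, `γ` and the `A`-fibres are
unchanged — so every term of `btw` is invariant (`btw_swap`) and **`A3Between_swap`**.

Hence the root-edge closure `A3Between_of_update_zero` (edges `{a₁, a₃}`) transfers to edges
`{a₂, a₃}` (`A3Between_of_update_zero_right`), to any root edge at `a₃` in either orientation
(`A3Between_of_update_zero_of_isRootEdge`) and to any finset of root edges at `a₃`
(`A3Between_of_zeroOn_rootEdges`; the two small bookkeeping lemmas `zeroOn_update_zero_comm` and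
`prob_PD_le_update_zero_left` are restated here so that this file depends only on
A3RootEdgeClosure), always under `D = P_p(PD) > 0`; finally
**`A3Between_of_noRootEdge_class`**: (MEANS-a₃) at `p` follows from (MEANS-a₃) on the weight
vectors of the same graph in which `a₃` has no root edge — the open content of (MEANS-a₃), like that
of the crux (`HCov_all_iff_noRootEdge_all`), lives on graphs where `a₃` has no root edge.
-/

namespace Summit.Ventures.PercRepro2

open UnionCluster

namespace CovForm

namespace A3Fibre

section Swap

variable {V : Type*} {E : Type*} [Fintype V] [DecidableEq V] [Fintype E] [DecidableEq E]
  {R : Type*} [Field R] [LinearOrder R]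

omit [Fintype V] [DecidableEq V] [LinearOrder R] in
/-- The fibre mass is symmetric in the roots. -/
lemma mW_swap (p : E → R) (ends : E → Sym2 V) (a₁ a₂ a₃ : V) (W : Finset V) :
    mW p ends a₂ a₁ a₃ W = mW p ends a₁ a₂ a₃ W := by
  unfold mW; rw [fibre_swap]

omit [Fintype V] [DecidableEq V] [LinearOrder R] in
/-- The `σ`-mass changes sign under the root swap. -/
lemma Ssig_swap (p : E → R) (ends : E → Sym2 V) (a₁ a₂ a₃ v : V) (W : Finset V) :
    Ssig p ends a₂ a₁ a₃ v W = -Ssig p ends a₁ a₂ a₃ v W := by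
  unfold Ssig; rw [fibre_swap]; ring

omit [Fintype V] [DecidableEq V] [LinearOrder R] in
/-- The `U`-mass is symmetric in the roots. -/
lemma Su_swap (p : E → R) (ends : E → Sym2 V) (a₁ a₂ a₃ v : V) (W : Finset V) :
    Su p ends a₂ a₁ a₃ v W = Su p ends a₁ a₂ a₃ v W := by
  unfold Su; rw [fibre_swap]; ring

omit [Fintype V] [DecidableEq V] [LinearOrder R] in
/-- `D_o` is symmetric in the roots. -/
lemma Do_swap (p : E → R) (ends : E → Sym2 V) (o a₁ a₂ a₃ : V) :
    Do p ends o a₂ a₁ a₃ = Do p ends o a₁ a₂ a₃ := by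
  unfold Do; rw [PDEvent_swap]; ring

omit [Fintype V] [DecidableEq V] [LinearOrder R] in
/-- `γ` is symmetric in the roots. -/
lemma gamma_swap (p : E → R) (ends : E → Sym2 V) (o a₁ a₂ a₃ : V) :
    gamma p ends o a₂ a₁ a₃ = gamma p ends o a₁ a₂ a₃ := by
  unfold gamma; rw [Do_swap, PDEvent_swap]

omit [Fintype V] [Fintype E] [DecidableEq E] [LinearOrder R] in
/-- The world sign changes sign under the root swap unless both roots lie in `W`. -/
lemma s3_swap_of_not_both {a₁ a₂ : V} {W : Finset V} (h : ¬ (a₁ ∈ W ∧ a₂ ∈ W)) :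
    s3 (R := R) a₂ a₁ W = -s3 a₁ a₂ W := by
  unfold s3
  by_cases h₁ : a₁ ∈ W
  · have h₂ : a₂ ∉ W := fun h₂ => h ⟨h₁, h₂⟩
    simp [h₁, h₂]
  · by_cases h₂ : a₂ ∈ W <;> simp [h₁, h₂]

omit [Fintype V] [DecidableEq V] [LinearOrder R] in
/-- On a fibre containing both roots every mass vanishes (the fibre is empty). -/
lemma masses_eq_zero_of_mem_mem (p : E → R) (ends : E → Sym2 V) (a₁ a₂ a₃ v : V) {W : Finset V}
    (h₁ : a₁ ∈ W) (h₂ : a₂ ∈ W) :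
    mW p ends a₁ a₂ a₃ W = 0 ∧ Ssig p ends a₁ a₂ a₃ v W = 0 ∧ Su p ends a₁ a₂ a₃ v W = 0 := by
  have hf := fibre_eq_empty_of_mem_mem ends a₁ a₂ a₃ h₁ h₂
  simp [mW, Ssig, Su, hf]

omit [Fintype V] [LinearOrder R] in
/-- The `F`-mass changes sign under the root swap. -/
lemma SF_swap (p : E → R) (ends : E → Sym2 V) (o a₁ a₂ a₃ : V) (W : Finset V) :
    SF p ends o a₂ a₁ a₃ W = -SF p ends o a₁ a₂ a₃ W := by
  by_cases h : a₁ ∈ W ∧ a₂ ∈ W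
  · obtain ⟨hm, hs, hu⟩ := masses_eq_zero_of_mem_mem p ends a₁ a₂ a₃ o h.1 h.2
    obtain ⟨hm', hs', hu'⟩ := masses_eq_zero_of_mem_mem p ends a₂ a₁ a₃ o h.2 h.1
    simp [SF, hm, hs, hu, hm', hs', hu']
  · unfold SF
    rw [Ssig_swap, s3_swap_of_not_both h, gamma_swap, mW_swap, Su_swap]
    ring

omit [Fintype E] [DecidableEq E] [LinearOrder R] in
/-- The `A`-fibres are symmetric in the roots. -/
lemma fibresA_swap (a₁ a₂ : V) : fibresA a₂ a₁ = fibresA a₁ a₂ := by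
  unfold fibresA
  exact Finset.filter_congr fun W _ => And.comm

omit [LinearOrder R] in
/-- **The means-level form `btw` is symmetric in the two roots.** -/
theorem btw_swap (p : E → R) (ends : E → Sym2 V) (o a₁ a₂ a₃ b : V) :
    btw p ends o a₂ a₁ a₃ b = btw p ends o a₁ a₂ a₃ b := by
  unfold btw
  rw [fibresA_swap, PDEvent_swap, avoidAll_symm ends a₁ a₂]
  simp only [Ssig_swap p ends a₁ a₂ a₃ b, SF_swap p ends o a₁ a₂ a₃, mW_swap p ends a₁ a₂ a₃,
    Su_swap p ends a₁ a₂ a₃ b, Su_swap p ends a₁ a₂ a₃ o, Finset.sum_neg_distrib,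
    neg_mul, mul_neg, neg_neg]

/-- **(MEANS-a₃) is symmetric in the two roots.** -/
theorem A3Between_swap (p : E → R) (ends : E → Sym2 V) (o a₁ a₂ a₃ b : V) :
    A3Between p ends o a₂ a₁ a₃ b ↔ A3Between p ends o a₁ a₂ a₃ b := by
  unfold A3Between; rw [btw_swap]

end Swap

end A3Fibre

namespace RootEdge

open A3Fibre

section Both

variable {V : Type*} {E : Type*} [Fintype V] [DecidableEq V] [Fintype E] [DecidableEq E]
  {R : Type*} [Field R] [LinearOrder R] [IsStrictOrderedRing R]

omit [Fintype V] [DecidableEq V] [Fintype E] [LinearOrder R] [IsStrictOrderedRing R] in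
/-- `zeroOn` and `update · e 0` commute. -/
lemma zeroOn_update_zero_comm (p : E → R) (e : E) (T : Finset E) :
    zeroOn (Function.update p e 0) T = Function.update (zeroOn p T) e 0 := by
  funext e'
  by_cases he : e' = e
  · subst he; simp [zeroOn]
  · simp [zeroOn, Function.update_of_ne he]

omit [Fintype V] [DecidableEq V] in
/-- Deleting a root edge at `a₃` cannot decrease `D`. -/
lemma prob_PD_le_update_zero_left (p : E → R) (hp : IsProbVec p) {ends : E → Sym2 V} {e : E} {a₁ a₂ a₃ : V}
    (hends : ends e = s(a₁, a₃)) :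
    prob p (PDEvent ends a₁ a₂ a₃) ≤ prob (Function.update p e 0) (PDEvent ends a₁ a₂ a₃) := by
  have hp₀ : IsProbVec (Function.update p e 0) := hp.update e le_rfl zero_le_one
  rw [prob_PD_eq_pin p hends]
  have h0 := prob_nonneg hp₀ (PDEvent ends a₁ a₂ a₃)
  have ht := hp.nonneg e
  nlinarith

/-- The root-edge closure of (MEANS-a₃) at an edge `e = {a₂, a₃}` (the root swap of
`A3Between_of_update_zero`). -/
theorem A3Between_of_update_zero_right (p : E → R) (hp : IsProbVec p) (ends : E → Sym2 V)
    (o a₁ a₂ a₃ b : V) (e : E) (hends : ends e = s(a₂, a₃))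
    (hD : 0 < prob (Function.update p e 0) (PDEvent ends a₁ a₂ a₃))
    (h₀ : A3Between (Function.update p e 0) ends o a₁ a₂ a₃ b) : A3Between p ends o a₁ a₂ a₃ b := by
  rw [← PDEvent_swap] at hD
  exact (A3Between_swap p ends o a₁ a₂ a₃ b).1
    (A3Between_of_update_zero p hp o b hends hD
      ((A3Between_swap (Function.update p e 0) ends o a₁ a₂ a₃ b).2 h₀))

omit [Fintype V] [DecidableEq V] in
/-- Deleting a root edge at `a₃` (either root, either orientation) cannot decrease `D`. -/
lemma prob_PD_le_update_zero_of_isRootEdge (p : E → R) (hp : IsProbVec p) (ends : E → Sym2 V)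
    (a₁ a₂ a₃ : V) (e : E) (he : IsRootEdge ends a₁ a₂ a₃ e) :
    prob p (PDEvent ends a₁ a₂ a₃) ≤ prob (Function.update p e 0) (PDEvent ends a₁ a₂ a₃) := by
  rcases he with h | h | h | h
  · exact prob_PD_le_update_zero_left p hp h
  · exact prob_PD_le_update_zero_left p hp (by rw [h, Sym2.eq_swap])
  · rw [← PDEvent_swap]; exact prob_PD_le_update_zero_left p hp h
  · rw [← PDEvent_swap]; exact prob_PD_le_update_zero_left p hp (by rw [h, Sym2.eq_swap])

/-- The root-edge closure of (MEANS-a₃) at any root edge at `a₃`. -/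
theorem A3Between_of_update_zero_of_isRootEdge (p : E → R) (hp : IsProbVec p) (ends : E → Sym2 V)
    (o a₁ a₂ a₃ b : V) (e : E) (he : IsRootEdge ends a₁ a₂ a₃ e)
    (hD : 0 < prob (Function.update p e 0) (PDEvent ends a₁ a₂ a₃))
    (h₀ : A3Between (Function.update p e 0) ends o a₁ a₂ a₃ b) : A3Between p ends o a₁ a₂ a₃ b := by
  rcases he with h | h | h | h
  · exact A3Between_of_update_zero p hp o b h hD h₀
  · exact A3Between_of_update_zero p hp o b (by rw [h, Sym2.eq_swap]) hD h₀
  · exact A3Between_of_update_zero_right p hp ends o a₁ a₂ a₃ b e h hD h₀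
  · exact A3Between_of_update_zero_right p hp ends o a₁ a₂ a₃ b e (by rw [h, Sym2.eq_swap]) hD h₀

/-- **Deleting any set of root edges at `a₃`** (either root): `A3Between (zeroOn p T) → A3Between p`
for every finset `T` of root edges at `a₃` and `D = P_p(PD) > 0`. -/
theorem A3Between_of_zeroOn_rootEdges (p : E → R) (hp : IsProbVec p) (ends : E → Sym2 V)
    (o a₁ a₂ a₃ b : V) (T : Finset E) (hT : ∀ e ∈ T, IsRootEdge ends a₁ a₂ a₃ e)
    (hD : 0 < prob p (PDEvent ends a₁ a₂ a₃))
    (h₀ : A3Between (zeroOn p T) ends o a₁ a₂ a₃ b) : A3Between p ends o a₁ a₂ a₃ b := by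
  induction T using Finset.induction_on generalizing p with
  | empty => simpa only [zeroOn_empty] using h₀
  | insert e T _ ih =>
    have hp₀ : IsProbVec (Function.update p e 0) := hp.update e le_rfl zero_le_one
    have he : IsRootEdge ends a₁ a₂ a₃ e := hT e (Finset.mem_insert_self e T)
    have hD₀ : 0 < prob (Function.update p e 0) (PDEvent ends a₁ a₂ a₃) :=
      lt_of_lt_of_le hD (prob_PD_le_update_zero_of_isRootEdge p hp ends a₁ a₂ a₃ e he)
    refine A3Between_of_update_zero_of_isRootEdge p hp ends o a₁ a₂ a₃ b e he hD₀ ?_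
    refine ih (Function.update p e 0) hp₀ (fun e' he' => hT e' (Finset.mem_insert_of_mem he'))
      hD₀ ?_
    rw [zeroOn_update_zero_comm, ← zeroOn_insert]
    exact h₀

/-- **(MEANS-a₃) from the class `NoRootEdge`**: if (MEANS-a₃) holds for every admissible weight
vector on the same graph and marks in which `a₃` has no root edge, it holds at every `p` with
`D = P_p(PD) > 0`. -/
theorem A3Between_of_noRootEdge_class (p : E → R) (hp : IsProbVec p) (ends : E → Sym2 V)
    (o a₁ a₂ a₃ b : V) (hD : 0 < prob p (PDEvent ends a₁ a₂ a₃))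
    (h : ∀ p' : E → R, IsProbVec p' → NoRootEdge p' ends a₁ a₂ a₃ → A3Between p' ends o a₁ a₂ a₃ b) :
    A3Between p ends o a₁ a₂ a₃ b := by
  classical
  refine A3Between_of_zeroOn_rootEdges p hp ends o a₁ a₂ a₃ b
    (Finset.univ.filter (IsRootEdge ends a₁ a₂ a₃)) (fun e he => (Finset.mem_filter.1 he).2) hD ?_
  exact h _ (isProbVec_zeroOn hp _) (noRootEdge_zeroOn_filter p ends a₁ a₂ a₃)

end Both

end RootEdge

end CovForm

end Summit.Ventures.PercRepro2
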